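import Summits.FinalStateConjecture.FinalStateConjecture.Theorems.BartnikGapSettlingGapExhaustionKerrRadiusBandCover
import HarnessLib

/-!
# `KerrRadiusOuterCover`: outward covering and exterior density for the Kerr–Schild cylinders
`{r = c}` (crux `GapExhaustion`, stmt-FinalStateConjecture-10808, line photon-shell-pseudoconvexity;
stub `stub_kerrRadius_outerCover` of the INWARD Killing-extension sweep, node stub S3)

The inward sweep runs the abstract level-set sweep with the level function `f = −r`,
`r = Kerr.radius a` the Kerr–Schild radius (the nonnegative root of
`r⁴ − (‖x⃗‖² − a²) r² − a² x₃² = 0`, Visser arXiv:0706.0622, (35)). For `0 < c`, `|a| ≤ c` it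
needs the two elementary facts mirror to those of the (S-2) file `KerrRadiusBandCover`:

* (outer cover) every point `y` with `|a| ≤ r(y) ≤ c`, `0 < r(y)`, is within distance
  `2 (c − r(y))` of a point `x` of the cylinder `{r = c}` with the same time coordinate;
* (exterior density) every point of the cylinder `{r = c}` lies in the closure of `{r > c}`.

Both follow from the **outward spatial scaling inequality** `μ r(t, x⃗) ≤ r(t, μ x⃗)` for
`1 ≤ μ` (`kerrOuterCover_radius_scale_ge`), the inverse form of the inward inequality
`kerrBandCover_radius_scale_le` (`r(t, μ' x⃗') ≤ μ' r(t, x⃗')` for `0 < μ' ≤ 1`, applied at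
`x⃗' = μ x⃗`, `μ' = μ⁻¹`). The cover point is produced by the intermediate value theorem along
`μ ↦ (y⁰, μ y⃗)`, `μ ∈ [1, c / r(y)]`, with the distance bound from `‖y⃗‖² ≤ r² + a² ≤ 2 r²`
(the defining quartic and `|a| ≤ r`); the density by letting `μ → 1⁺`. [folklore]
-/

noncomputable section

-- D-0017: single-problem summit, `Summit.<S>.<S>.…` by design (cf. lakefile `weak.linter.dupNamespace`).
set_option linter.dupNamespace false

namespace Summit.FinalStateConjecture.FinalStateConjecture.Theorems

open Set Literature.Geometry.Lorentzian
open scoped Topology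

/-- **Outward spatial scaling grows the Kerr–Schild radius at least linearly**: for `1 ≤ μ`,
`μ r_a(t, x⃗) ≤ r_a(t, μ x⃗)`. This is the inward inequality `kerrBandCover_radius_scale_le`
(`r(t, μ' x⃗') ≤ μ' r(t, x⃗')` for `0 < μ' ≤ 1`) at `x⃗' = μ x⃗`, `μ' = μ⁻¹`; ultimately the
joint homogeneity and the spin-monotonicity of the defining quartic
(Visser arXiv:0706.0622, (35)). [folklore] -/
theorem kerrOuterCover_radius_scale_ge (a : ℝ) (y : E4) {μ : ℝ} (hμ1 : 1 ≤ μ) :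
    μ * Kerr.radius a y ≤ Kerr.radius a (E4.ofTimeSpace (y 0) (μ • E4.spatial y)) := by
  have hμ0 : 0 < μ := one_pos.trans_le hμ1
  have h := kerrBandCover_radius_scale_le a (E4.ofTimeSpace (y 0) (μ • E4.spatial y))
    (inv_pos.2 hμ0) (inv_le_one_of_one_le₀ hμ1)
  rw [E4.ofTimeSpace_apply_zero, E4.spatial_ofTimeSpace, inv_smul_smul₀ hμ0.ne',
    Kerr.radius_eq_of_spatial_eq a (E4.spatial_ofTimeSpace (y 0) (E4.spatial y))] at h
  exact (le_inv_mul_iff₀ hμ0).1 h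

/-- The displacement of the spatial scaling `(y⁰, y⃗) ↦ (y⁰, μ y⃗)` has norm `|μ − 1| ‖y⃗‖`
(Euclidean norm of `E4 = EuclideanSpace ℝ (Fin 4)`; same computation as in
`KerrRadiusBandCover`). [folklore] -/
private theorem kerrOuterCover_norm_sub (y : E4) (μ : ℝ) :
    ‖E4.ofTimeSpace (y 0) (μ • E4.spatial y) - y‖ = |μ - 1| * E4.spatialNorm y := by
  have h : E4.ofTimeSpace (y 0) (μ • E4.spatial y) - y =
      E4.ofTimeSpace 0 ((μ - 1) • E4.spatial y) := by
    ext i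
    refine Fin.cases ?_ (fun j ↦ ?_) i
    · simp
    · simp [sub_mul]
  have hn : ∀ v : E3, ‖E4.ofTimeSpace 0 v‖ = ‖v‖ := fun v ↦ by
    rw [EuclideanSpace.norm_eq, EuclideanSpace.norm_eq, Fin.sum_univ_succ]
    simp
  rw [h, hn, norm_smul, Real.norm_eq_abs, E4.spatialNorm]

/-- `‖y⃗‖² ≤ r² + a²` wherever `r > 0`: the defining quartic gives
`(‖y⃗‖² − a²) r² = r⁴ − a² y₃² ≤ r⁴` (Visser arXiv:0706.0622, (35); the level sets are the
confocal ellipsoids `(y₁² + y₂²)/(r² + a²) + y₃²/r² = 1`). [folklore] -/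
private theorem kerrOuterCover_spatialNorm_sq_le (a : ℝ) {y : E4} (hy : 0 < Kerr.radius a y) :
    E4.spatialNorm y ^ 2 ≤ Kerr.radius a y ^ 2 + a ^ 2 := by
  have hq := Kerr.radius_quartic a y
  have hr2 : 0 < Kerr.radius a y ^ 2 := by positivity
  by_contra h
  have hlt : Kerr.radius a y ^ 2 * Kerr.radius a y ^ 2 <
      (E4.spatialNorm y ^ 2 - a ^ 2) * Kerr.radius a y ^ 2 :=
    mul_lt_mul_of_pos_right (by linarith [not_le.mp h]) hr2
  nlinarith [sq_nonneg (a * y 3)]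

/-- `‖y⃗‖ ≤ 2 r(y)` as soon as `|a| ≤ r(y)` and `0 < r(y)`:
`‖y⃗‖² ≤ r² + a² ≤ 2 r² ≤ (2 r)²` (Visser arXiv:0706.0622, (35)). [folklore] -/
private theorem kerrOuterCover_spatialNorm_le_two_mul (a : ℝ) {y : E4}
    (ha : |a| ≤ Kerr.radius a y) (hy : 0 < Kerr.radius a y) :
    E4.spatialNorm y ≤ 2 * Kerr.radius a y := by
  have h1 := kerrOuterCover_spatialNorm_sq_le a hy
  have h2 : a ^ 2 ≤ Kerr.radius a y ^ 2 := by
    simpa only [sq_abs] using pow_le_pow_left₀ (abs_nonneg a) ha 2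
  have h3 : E4.spatialNorm y ^ 2 ≤ (2 * Kerr.radius a y) ^ 2 := by nlinarith
  exact (sq_le_sq₀ (E4.spatialNorm_nonneg y) (by positivity)).1 h3

/-- **Outward covering and exterior density of the Kerr–Schild cylinders.** For `0 < c`,
`|a| ≤ c`: every point `y` with `|a| ≤ r(y) ≤ c`, `0 < r(y)`, is within `2 (c − r(y))` of a
point of the level cylinder `{r = c}` at the same time (outward spatial scaling `x⃗ ↦ μ x⃗`,
`μ r(t, x⃗) ≤ r(t, μ x⃗)` for `1 ≤ μ`, the intermediate value theorem on `μ ∈ [1, c / r(y)]`,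
and `‖y⃗‖ ≤ 2 r(y)`), and every point of `{r = c}` is in the closure of `{r > c}` (let
`μ → 1⁺`: `r(t, μ x⃗) ≥ μ c > c`). Elementary geometry of the confocal ellipsoids `{r = c}` of
the Kerr–Schild radius (O'Neill 1995, Ch. 2, §2.1; Visser arXiv:0706.0622, (35)). [folklore] -/
theorem stub_kerrRadius_outerCover :
    ∀ (a c : ℝ), 0 < c → |a| ≤ c →
      (∀ y : E4, |a| ≤ Kerr.radius a y → 0 < Kerr.radius a y → Kerr.radius a y ≤ c →
        ∃ x : E4, Kerr.radius a x = c ∧ x 0 = y 0 ∧ ‖x - y‖ ≤ 2 * (c - Kerr.radius a y)) ∧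
      (∀ x : E4, Kerr.radius a x = c → x ∈ closure {y : E4 | c < Kerr.radius a y}) := by
  intro a c hc _hac
  refine ⟨fun y hay hr0 hyc ↦ ?_, fun x hx ↦ ?_⟩
  · -- (outer cover): IVT along the outward spatial scaling path `μ ↦ (y⁰, μ y⃗)`,
    -- `μ ∈ [1, μ₁]`, `μ₁ = c / r(y)`
    obtain ⟨p, hp⟩ : ∃ p : ℝ → E4, p = fun μ ↦ E4.ofTimeSpace (y 0) (μ • E4.spatial y) :=
      ⟨_, rfl⟩
    have hpc : Continuous p := by
      rw [hp]
      exact (E4.continuous_ofTimeSpace (y 0)).comp (continuous_id.smul continuous_const)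
    have hφc : Continuous fun μ ↦ Kerr.radius a (p μ) := (Kerr.continuous_radius a).comp hpc
    have hφ1 : Kerr.radius a (p 1) = Kerr.radius a y := by
      rw [hp]
      simp only [one_smul]
      exact Kerr.radius_eq_of_spatial_eq a (E4.spatial_ofTimeSpace _ _)
    obtain ⟨μ₁, hμ₁⟩ : ∃ μ₁ : ℝ, μ₁ = c / Kerr.radius a y := ⟨_, rfl⟩
    have hμ₁1 : 1 ≤ μ₁ := by
      rw [hμ₁]
      exact (one_le_div hr0).2 hyc
    have hμ₁r : μ₁ * Kerr.radius a y = c := by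
      rw [hμ₁]
      exact div_mul_cancel₀ c hr0.ne'
    have hφμ₁ : c ≤ Kerr.radius a (p μ₁) := by
      rw [← hμ₁r, hp]
      exact kerrOuterCover_radius_scale_ge a y hμ₁1
    obtain ⟨μ, ⟨hμ1, hμ2⟩, hμc⟩ := intermediate_value_Icc hμ₁1 hφc.continuousOn
      (show c ∈ Icc (Kerr.radius a (p 1)) (Kerr.radius a (p μ₁)) from
        ⟨by rw [hφ1]; exact hyc, hφμ₁⟩)
    have hμc : Kerr.radius a (p μ) = c := hμc
    refine ⟨p μ, hμc, by rw [hp]; exact E4.ofTimeSpace_apply_zero _ _, ?_⟩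
    -- the distance estimate `‖(y⁰, μ y⃗) − y‖ = (μ − 1) ‖y⃗‖ ≤ (μ₁ − 1) 2 r = 2 (c − r)`
    have hS : E4.spatialNorm y ≤ 2 * Kerr.radius a y :=
      kerrOuterCover_spatialNorm_le_two_mul a hay hr0
    rw [hp, kerrOuterCover_norm_sub, abs_of_nonneg (sub_nonneg.2 hμ1)]
    calc (μ - 1) * E4.spatialNorm y ≤ (μ₁ - 1) * (2 * Kerr.radius a y) :=
        mul_le_mul (sub_le_sub_right hμ2 1) hS (E4.spatialNorm_nonneg y) (by linarith)
      _ = 2 * (c - Kerr.radius a y) := by linear_combination 2 * hμ₁r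
  · -- (exterior density): `(x⁰, μ x⃗) → x` as `μ → 1⁺`, with `r(x⁰, μ x⃗) ≥ μ c > c`
    obtain ⟨p, hp⟩ : ∃ p : ℝ → E4, p = fun μ ↦ E4.ofTimeSpace (x 0) (μ • E4.spatial x) :=
      ⟨_, rfl⟩
    have hpc : Continuous p := by
      rw [hp]
      exact (E4.continuous_ofTimeSpace (x 0)).comp (continuous_id.smul continuous_const)
    have hp1 : p 1 = x := by
      rw [hp]
      simp only [one_smul]
      exact E4.ofTimeSpace_time_spatial x
    have ht : Filter.Tendsto p (𝓝[>] 1) (𝓝 x) := by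
      have h : Filter.Tendsto p (𝓝[>] 1) (𝓝 (p 1)) :=
        (hpc.tendsto 1).mono_left nhdsWithin_le_nhds
      rwa [hp1] at h
    refine mem_closure_of_tendsto ht ?_
    filter_upwards [self_mem_nhdsWithin] with μ hμ
    show c < Kerr.radius a (p μ)
    calc c < μ * c := lt_mul_of_one_lt_left hc hμ
      _ = μ * Kerr.radius a x := by rw [hx]
      _ ≤ Kerr.radius a (p μ) := by
          rw [hp]
          exact kerrOuterCover_radius_scale_ge a x (le_of_lt hμ)

end Summit.FinalStateConjecture.FinalStateConjecture.Theorems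

end
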